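import Mathlib

/-!
# SoloBlind — the purity lemma for involution modules (THEOREM P of the solo-blind programme, s34)

Abstract algebra behind the level decomposition of the "death list" of Anderson–Das torsion classes
(`paper/hafnian-theorem.md` §11, s34).  Let `X` be an abelian group with an involution `c` (in the
application: Kubert's universal ordinary distribution of level `M` modulo the multiplication relations,
`c [a] = [-a]`), `A := X ⧸ (1+c)X` (the odd quotient `U_M ⧸ (R_M + MU_M)`), and `V ⊆ X` a `c`-stable subgroup
with `X ⧸ V` free of `2`-torsion (a sum of sub-distributions of lower levels, Kubert 1979).  The torsion of
`A` is represented by the `c`-fixed elements of `X`.  PURITY: a `c`-fixed `x` lies in `V + 2X + (1+c)X` only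
if it is congruent modulo `(1+c)X` to a `c`-FIXED element of `V`; i.e.
`tors A ∩ (image of V + 2A) = image of tors (V ⧸ (1+c)V)`.  With `V = 0`: `tors A → A ⧸ 2A` is injective.

* `purity` — the lemma, with explicit witnesses;
* `purity_iff` — the same as an equivalence;
* `fixed_mem_two_add_norm` — the case `V = ⊥` (no `2`-torsion in `X`): a `c`-fixed element of
  `2X + (1+c)X` lies in `(1+c)X`.

All proofs are elementary identities in abelian groups (`abel`) plus the one use of `2`-torsion-freeness.
-/

namespace Summit.KontsevichZagierPeriods.KontsevichZagierPeriods.Theorems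
namespace SoloBlind
namespace Purity

variable {X : Type*} [AddCommGroup X]

/-- PURITY LEMMA.  `c` an involution of the abelian group `X`, `V` a `c`-stable subgroup such that `X ⧸ V`
has no `2`-torsion (`y + y ∈ V → y ∈ V`).  If a `c`-fixed `x` decomposes as `x = v + (y + y) + (w + c w)`
with `v ∈ V`, then `x = v' + (w' + c w')` for some `c`-fixed `v' ∈ V` (namely `v' = v + (y - c y)`,
`w' = y + w`). -/
theorem purity (c : X →+ X) (hc : ∀ x, c (c x) = x) (V : AddSubgroup X)
    (hV : ∀ x ∈ V, c x ∈ V) (htf : ∀ y : X, y + y ∈ V → y ∈ V)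
    {x v y w : X} (hx : c x = x) (hv : v ∈ V) (h : x = v + (y + y) + (w + c w)) :
    ∃ v' ∈ V, c v' = v' ∧ ∃ w' : X, x = v' + (w' + c w') := by
  -- apply `c` to the decomposition and compare with `x = c x`
  have hcx : c x = c v + (c y + c y) + (c w + w) := by
    rw [h, map_add, map_add, map_add, map_add, hc]
  have E : v + (y + y) + (w + c w) = c v + (c y + c y) + (c w + w) := by
    rw [← h, ← hcx, hx]
  -- hence `(y - c y) + (y - c y) = c v - v ∈ V`, so `y - c y ∈ V`
  have hdiff : (y - c y) + (y - c y) = c v - v := by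
    have E0 : v + (y + y) + (w + c w) - (c v + (c y + c y) + (c w + w)) = 0 := sub_eq_zero.mpr E
    calc (y - c y) + (y - c y)
        = (v + (y + y) + (w + c w) - (c v + (c y + c y) + (c w + w))) + (c v - v) := by abel
      _ = c v - v := by rw [E0, zero_add]
  have hkey : y - c y ∈ V := by
    apply htf
    rw [hdiff]
    exact V.sub_mem (hV v hv) hv
  refine ⟨v + (y - c y), V.add_mem hv hkey, ?_, y + w, ?_⟩
  · -- `c (v + (y - c y)) = c v + (c y - y) = v + (y - c y)` by the relation `hdiff`
    rw [map_add, map_sub, hc]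
    have : c v + (c y - y) - (v + (y - c y)) = 0 := by
      calc c v + (c y - y) - (v + (y - c y))
          = (c v - v) - ((y - c y) + (y - c y)) := by abel
        _ = 0 := by rw [hdiff, sub_self]
    exact sub_eq_zero.mp this
  · rw [map_add, h]
    abel

/-- PURITY as an equivalence: for a `c`-fixed `x`, membership in `V + 2X + (1+c)X` is the same as
membership in `V^c + (1+c)X` (`V^c` = the `c`-fixed part of `V`). -/
theorem purity_iff (c : X →+ X) (hc : ∀ x, c (c x) = x) (V : AddSubgroup X)
    (hV : ∀ x ∈ V, c x ∈ V) (htf : ∀ y : X, y + y ∈ V → y ∈ V) {x : X} (hx : c x = x) :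
    (∃ v ∈ V, ∃ y w : X, x = v + (y + y) + (w + c w)) ↔
      (∃ v' ∈ V, c v' = v' ∧ ∃ w' : X, x = v' + (w' + c w')) := by
  constructor
  · rintro ⟨v, hv, y, w, h⟩
    exact purity c hc V hV htf hx hv h
  · rintro ⟨v', hv', -, w', h⟩
    exact ⟨v', hv', 0, w', by rw [h, add_zero, add_zero]⟩

/-- The case `V = ⊥`: if `X` has no `2`-torsion, a `c`-fixed element of `2X + (1+c)X` already lies in
`(1+c)X`.  (In the application: the torsion of `A = X ⧸ (1+c)X` injects into `A ⧸ 2A`.) -/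
theorem fixed_mem_two_add_norm (c : X →+ X) (hc : ∀ x, c (c x) = x)
    (h2 : ∀ y : X, y + y = 0 → y = 0) {x y w : X} (hx : c x = x)
    (h : x = (y + y) + (w + c w)) : ∃ w' : X, x = w' + c w' := by
  have h' : x = 0 + (y + y) + (w + c w) := by rw [zero_add]; exact h
  obtain ⟨v', hv', -, w', hw'⟩ :=
    purity c hc (⊥ : AddSubgroup X) (fun x hx0 => by
        rw [AddSubgroup.mem_bot] at hx0 ⊢; rw [hx0, map_zero])
      (fun y hy => by rw [AddSubgroup.mem_bot] at hy ⊢; exact h2 y hy) hx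
      (AddSubgroup.zero_mem _) h'
  rw [AddSubgroup.mem_bot] at hv'
  exact ⟨w', by rw [hw', hv', zero_add]⟩

end Purity
end SoloBlind
end Summit.KontsevichZagierPeriods.KontsevichZagierPeriods.Theorems
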